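import Literature.NumberTheory.EllipticCurves.BhargavaSkinnerZhang2014.CellBookkeeping
import HarnessLib

/-!
# Bhargava–Skinner–Zhang 2014, §3 bookkeeping (iii): the cited theorems as named hypotheses, and the multi-cell percentage theorem

Source: M. Bhargava, C. Skinner, W. Zhang, *A majority of elliptic curves over `ℚ` satisfy the Birch and Swinnerton-Dyer
conjecture*, arXiv:1407.1826v2 (2014) [BhargavaSkinnerZhang2014], §2 (the cited inputs: Thm. 5 rank-`0` converse, Thm. 9
rank-`1` converse, Thm. 13 Selmer average, Thm. 15 parity, Thm. 16 root numbers, Remark 8 / proof of Thm. 9 for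
Gross–Zagier–Kolyvagin) and §3 (Lemmas 17–20, Thms. 21/23/25, Cors. 22/24/26, Thm. 1).

Reproduction, ABSTRACT and PROVED.  This file contains NO arithmetic of elliptic curves: every cited theorem is a named `Prop` about
the abstract `Invariants` of the height family (`CellBookkeeping`; dictionary to the tree's `WeierstrassCurve.*` there), stated in
exactly the form in which the BSZ bookkeeping consumes it, with its source and the place where it is used:

| name | informal content | source | used in |
|---|---|---|---|
| `SelmerAverageLE inv p F` | `avg_{F} #Sel_p ≤ p + 1` (count form) | [BSZ Thm 13] = Bhargava–Shankar, `p ≤ 5`, `F` large | `Cell.Holds.average` |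
| `TwistPaired inv U` | `U` is stable under `E ↦ E₋₁` and `w(E₋₁) = -w(E)` on `U` | [BSZ Thm 16 and §2.4], `F` defined mod powers of primes `≡ 1 (4)`, `μ(U) ≥ .5501 μ(F)` | `Cell.Holds.paired`, `.relDensity` |
| `SelmerParityOn inv p G` | `s_p(E) ≡ 0 (2) ↔ w(E) = +1` when `E(ℚ)[p] = 0` | Dokchitser–Dokchitser [BSZ Thm 15] | `Cell.Holds.parity` |
| `GrossZagierKolyvagin inv` | `ord L ≤ 1 ⇒ rank = ord L ∧ Ш finite` | Gross–Zagier, Kolyvagin | `Cell.Holds.gzk` |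
| `RankZeroConverseOn inv p C G` | `Sel_p = 0 ⇒ L(E,1) ≠ 0` on `C ∩ G` | Skinner–Urban, Skinner [BSZ Thm 5]; BSTW24 Thm 1.6 (ss, semistable) | `Cell.Holds.rankZero` |
| `RankOneConverseOn inv p C G` | `#Sel_p = p ⇒ ord L = 1` on `C ∩ G` | W. Zhang, Skinner–Zhang [BSZ Thm 9]; BCS24 Thm 1.2.2; Cas24 Thm 1.1; Castella–Wan (Math. Ann. 2024) Thm A / Cor B | `Cell.Holds.rankOne` |
| `DensityGE C μ`, `DensityLE E ν` | `μ(C) ≥ μ`, `μ̄(E) ≤ ν` | [BSZ Lemmas 17–20, (mu-diff)], Bhargava–Shankar product formula; this bundle's `ResidueCount` | `Cell.Holds.density`, `.exceptional` |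

Main results: `Cell.heightDensityGE` (one cell: under `Cell.Holds`, the lower density of `{BSD, rank ≤ 1} ∩ C` is `≥ Cell.value`,
by the three cell theorems of `CellBookkeeping`) and `bsd_percentage` (pairwise disjoint cells add up, `CellUnion`).  The hypothesis
`Prop`s are BINDERS of these theorems — nothing here asserts that they hold; which printed theorem discharges which binder on which
cell, and with what density, is the business of the consumer (the `pub-bsdpct` bundle's `Headline.lean`, Summit-side).

Relation to the tree: the tree's `LeadingTermBSZAssemblyProofs.lean` / `LeadingTermBSZ.lean` state BSZ's hypotheses CONCRETELY
(over `WeierstrassCurve.mordellWeilRank`, `selmerGroup`, `rootNumber`, …) for the one-cell `p = 5` assembly; the present file is the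
abstract multi-cell interface.  New relative to BSZ: the `Mode` of a cell (both converses / rank-`0` only / rank-`1` only) and the
explicit exceptional density `ν` with its coefficient (`Cell.value` docstring).
Origin: `BSDPercentage/Statement.lean` (sha256 6649ed05…, run of record 72) of the `pub-bsdpct` bundle's staged package
(BirchSwinnertonDyer / bsd-percentage), namespace-rewritten `BSDPercentage → Literature.NumberTheory.EllipticCurves.BhargavaSkinnerZhang2014` (LEAN-IN-TREE rule, 2026-08-18); statements
byte-identical; one proof adapted to the tree's classical `HeightDensityGE.eventually_mul_card_le` (`densityGE_of_heightDensityGE`),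
docstrings added to the fields of `Cell.Holds`.  "BSZ" / "paper §2, H5/H6" in the docstrings refer to the cited source and to that
bundle's paper.

What is NOT here: the cells, constants and percentages (the bundle's `Headline.lean`, `AdditiveCell.lean`, …), the fourth mode
(rank-`1` converse under a residual local condition, the bundle's `LocalCondition.lean`), any instance of the hypotheses.
-/

noncomputable section

open scoped Classical
open Filter Topology Finset

namespace Literature.NumberTheory.EllipticCurves.BhargavaSkinnerZhang2014

/-! ### Density hypotheses in count form -/

/-- `F` has lower density `≥ μ` among all curves ordered by height (count form: for every `η > 0`,
eventually `(μ - η)·N(X) ≤ #F_X`). [cite: BhargavaSkinnerZhang2014, §3.1] -/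
def DensityGE (F : ℤ × ℤ → Prop) [DecidablePred F] (μ : ℝ) : Prop :=
  ∀ η : ℝ, 0 < η → ∀ᶠ X : ℕ in atTop,
    (μ - η) * (heightFamilyBelow X).card ≤ ((heightFamilyBelow X).filter F).card

/-- `U` has relative lower density `≥ κ` inside `C` (count form). [cite: BhargavaSkinnerZhang2014, Thm 16] -/
def RelDensityGE (U C : ℤ × ℤ → Prop) [DecidablePred U] [DecidablePred C] (κ : ℝ) : Prop :=
  ∀ η : ℝ, 0 < η → ∀ᶠ X : ℕ in atTop,
    (κ - η) * ((heightFamilyBelow X).filter C).card ≤ ((heightFamilyBelow X).filter U).card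

/-- `F` has upper density `≤ ν` (count form). [cite: BhargavaSkinnerZhang2014, (mu-diff), Lemma 20] -/
def DensityLE (F : ℤ × ℤ → Prop) [DecidablePred F] (ν : ℝ) : Prop :=
  ∀ η : ℝ, 0 < η → ∀ᶠ X : ℕ in atTop,
    (((heightFamilyBelow X).filter F).card : ℝ) ≤ (ν + η) * (heightFamilyBelow X).card

/-- A genuine lower density gives the count form. [folklore] -/
theorem densityGE_of_heightDensityGE {F : ℤ × ℤ → Prop} [DecidablePred F] {μ : ℝ}
    (h : HeightDensityGE F μ) :
    DensityGE F μ := by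
  intro η hη
  filter_upwards [HeightDensityGE.eventually_mul_card_le h η hη] with X hX
  convert hX

/-! ### The cited theorems, as named hypotheses on the abstract invariants -/

/-- **Selmer average** on the family `F`: for every `η > 0`, eventually
`Σ_{E ∈ F, H(E) < X} #Sel_p(E) ≤ (p + 1 + η)·#{E ∈ F : H(E) < X}` (with `#Sel_p = p ^ s_p`).  This is the
count form of "the average size of the `p`-Selmer group in the large family `F` is `p + 1`"
(Bhargava–Shankar, `p = 2, 3, 5`). [cite: BhargavaSkinnerZhang2014, Thm 13] -/
def SelmerAverageLE (inv : Invariants) (p : ℕ) (F : ℤ × ℤ → Prop) [DecidablePred F] : Prop :=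
  ∀ η : ℝ, 0 < η → ∀ᶠ X : ℕ in atTop,
    ∑ AB ∈ (heightFamilyBelow X).filter F, (p : ℝ) ^ inv.selmerRank p AB
      ≤ (p + 1 + η) * ((heightFamilyBelow X).filter F).card

/-- **Twist-paired subfamily**: `U` is stable under `E_{A,B} ↦ E_{A,-B}` and the root numbers of `E` and
`E₋₁` have opposite signs for `E ∈ U` (the property "by construction" of the subfamily `F'` of BSZ Thm 16).
[cite: BhargavaSkinnerZhang2014, Thm 16 and §2.4] -/
def TwistPaired (inv : Invariants) (U : ℤ × ℤ → Prop) : Prop :=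
  (∀ AB, U AB → U (negB AB)) ∧ (∀ AB, U AB → inv.rootNumber (negB AB) = -inv.rootNumber AB)

/-- The global root number is `±1`. [folklore] -/
def RootNumberSign (inv : Invariants) : Prop :=
  ∀ AB, inv.rootNumber AB = 1 ∨ inv.rootNumber AB = -1

/-- **Selmer parity** on `G`: for `E ∈ G` in the height family, `s_p(E)` is even iff `w(E) = +1`
(Dokchitser–Dokchitser: `s_p(E) - dim E(ℚ)[p] ≡ ord` parity of the root number; on `G` one has
`E(ℚ)[p] = 0`). [cite: BhargavaSkinnerZhang2014, Thm 15] -/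
def SelmerParityOn (inv : Invariants) (p : ℕ) (G : ℤ × ℤ → Prop) : Prop :=
  ∀ AB, IsInHeightFamily AB → G AB → (Even (inv.selmerRank p AB) ↔ inv.rootNumber AB = 1)

/-- **Gross–Zagier–Kolyvagin**: `ord_{s=1} L(E,s) ≤ 1 ⇒ rank E(ℚ) = ord_{s=1} L(E,s)` and `Ш(E/ℚ)` is
finite. [cite: BhargavaSkinnerZhang2014, §2.1 (Remark 8) and proof of Thm 9] -/
def GrossZagierKolyvagin (inv : Invariants) : Prop :=
  ∀ AB, IsInHeightFamily AB → inv.analyticRank AB ≤ 1 →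
    inv.rank AB = inv.analyticRank AB ∧ inv.shaFinite AB

/-- **Rank-zero converse** on the cell `C` off the exceptional set: for `E ∈ C ∩ G` in the height family,
`Sel_p(E) = 0 ⇒ ord_{s=1} L(E,s) = 0`. Instances: Skinner–Urban + Skinner (good ordinary or multiplicative
`p`, BSZ Thm 5 (a)–(d)); Burungale–Skinner–Tian–Wan 2024 Thm 1.6 (supersingular `p > 2`, `E` semistable).
BRIDGE to the printed statements (which assume `Sel_{p^∞}(E/ℚ)` finite or of corank `0`): `Sel_p(E) = 0`
implies `Sel_{p^∞}(E)[p] = 0`, hence `Sel_{p^∞}(E) = 0`, with no hypothesis (paper §2, H5).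
[cite: BhargavaSkinnerZhang2014, Thm 5] -/
def RankZeroConverseOn (inv : Invariants) (p : ℕ) (C G : ℤ × ℤ → Prop) : Prop :=
  ∀ AB, IsInHeightFamily AB → C AB → G AB → inv.selmerRank p AB = 0 → inv.analyticRank AB = 0

/-- **Rank-one converse** on the cell `C` off the exceptional set: for `E ∈ C ∩ G` in the height family,
`#Sel_p(E) = p ⇒ ord_{s=1} L(E,s) = 1`. Instances: W. Zhang + Skinner–Zhang (BSZ Thm 9 (a)–(f), `p ≥ 5`
ordinary); Burungale–Castella–Skinner 2024 Thm 1.2.2(a) / BSTW24 Thm 1.10 (good ordinary `p > 3`);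
Castella 2024 Thm 1.1 (multiplicative `p > 3`); Castella–Wan, Math. Ann. 389 (2024), Thm A / Cor B (supersingular
`p > 3`, `E` semistable, no further hypothesis).
BRIDGE to the printed statements (which assume `corank_{ℤ_p} Sel_{p^∞}(E/ℚ) = 1`): this Prop is only ever
instantiated with `G ⊆ {E[p] irreducible}`, so `E(ℚ)[p] = 0`, `Sel_p(E) ≅ Sel_{p^∞}(E)[p]`, and
`dim Sel_p = 1` forces corank `1` (corank `0` would make `Ш[p^∞]` finite of odd `p`-rank, contradicting
the alternating Cassels–Tate pairing) — BSZ's proof of Thm 9; paper §2, H6.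
[cite: BhargavaSkinnerZhang2014, Thm 9] -/
def RankOneConverseOn (inv : Invariants) (p : ℕ) (C G : ℤ × ℤ → Prop) : Prop :=
  ∀ AB, IsInHeightFamily AB → C AB → G AB → inv.selmerRank p AB = 1 → inv.analyticRank AB = 1

/-! ### Cells -/

/-- Which converse theorems are available on a cell (the three bookkeeping shapes of BSZ §3).
[cite: BhargavaSkinnerZhang2014, Thms 21, 23, 25] -/
inductive Mode where
  /-- both converses (BSZ Thm 25 / Cor 26 shape) -/
  | both
  /-- only the rank-`0` converse (BSZ Thm 21 / Cor 22 shape) -/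
  | rankZero
  /-- only the rank-`1` converse (BSZ Thm 23 / Cor 24 shape) -/
  | rankOne

/-- A cell of the bookkeeping: a prime `p`, the cell `C` (a large family), its twist-paired subfamily
`U ⊆ C`, the good set `G`, the density data `μ(C) ≥ μ`, `μ(U)/μ(C) ≥ κ`, `μ̄(C ∖ G) ≤ ν`, and the mode.
[cite: BhargavaSkinnerZhang2014, §3] -/
structure Cell where
  /-- the prime used for Selmer statistics on this cell -/
  p : ℕ
  /-- the cell -/
  C : ℤ × ℤ → Prop
  /-- the twist-paired (equidistributed) subfamily -/
  U : ℤ × ℤ → Prop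
  /-- the good set: density-one conditions and side conditions of the converse theorems -/
  G : ℤ × ℤ → Prop
  /-- lower density of the cell -/
  μ : ℝ
  /-- relative lower density of `U` in `C` -/
  κ : ℝ
  /-- upper density of the exceptional set `C ∖ G` -/
  ν : ℝ
  /-- available converses -/
  mode : Mode

/-- The guaranteed proportion of all curves that lie in the cell and satisfy BSD with rank `≤ 1`:
`both`: `((p²-p-1 + (p-1)κ/2)μ - (p²+p-2)ν)/(p²-1)`; `rankZero`: `((p²-p-2)κμ/2 - (2p²+p-3)ν)/(p²-1)`;
`rankOne`: `(((p³-1)/2 - p)κμ - (2p³-p-1)ν)/(p³-p)`.  The exceptional density `ν` enters with a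
coefficient `> 1` (`(p+2)/(p+1)` in mode `both`) because curves of `C ∖ G` are lost twice: once in the
parity count (parity is only available on `G`) and once when the converses are applied; BSZ charge
`(7/8 + 19/24)·ν` at `p = 5`, which is larger still.
[cite: BhargavaSkinnerZhang2014, Thms 21, 23, 25] -/
def Cell.value (c : Cell) : ℝ :=
  match c.mode with
  | Mode.both => ((((c.p : ℝ) ^ 2 - c.p - 1) + ((c.p : ℝ) - 1) * c.κ / 2) * c.μ
      - ((c.p : ℝ) ^ 2 + c.p - 2) * c.ν) / ((c.p : ℝ) ^ 2 - 1)
  | Mode.rankZero => ((((c.p : ℝ) ^ 2 - c.p - 2) / 2) * c.κ * c.μ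
      - (2 * (c.p : ℝ) ^ 2 + c.p - 3) * c.ν) / ((c.p : ℝ) ^ 2 - 1)
  | Mode.rankOne => ((((c.p : ℝ) ^ 3 - 1) / 2 - c.p) * c.κ * c.μ
      - (2 * (c.p : ℝ) ^ 3 - c.p - 1) * c.ν) / ((c.p : ℝ) ^ 3 - c.p)

/-- The family on which the Selmer average is taken: the cell itself in mode `both`, the twist-paired
subfamily otherwise. [cite: BhargavaSkinnerZhang2014, Thms 21, 23, 25] -/
def Cell.averagingFamily (c : Cell) : ℤ × ℤ → Prop :=
  match c.mode with
  | Mode.both => c.C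
  | Mode.rankZero => c.U
  | Mode.rankOne => c.U

/-- **The hypotheses of a cell**: every field is either elementary bookkeeping or one of the named
cited theorems above, restricted to the cell. [cite: BhargavaSkinnerZhang2014, §3] -/
structure Cell.Holds (inv : Invariants) (c : Cell) : Prop where
  /-- `2 ≤ p` -/
  hp : 2 ≤ c.p
  /-- `U ⊆ C` -/
  hUC : ∀ AB, c.U AB → c.C AB
  /-- `U` is twist-paired (BSZ Thm 16) -/
  paired : TwistPaired inv c.U
  /-- root numbers are `±1` -/
  sign : RootNumberSign inv
  /-- `p`-Selmer parity on the good set (BSZ Thm 15) -/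
  parity : SelmerParityOn inv c.p c.G
  /-- Gross–Zagier–Kolyvagin -/
  gzk : GrossZagierKolyvagin inv
  /-- `μ(C) ≥ μ` -/
  density : DensityGE c.C c.μ
  /-- `μ(U | C) ≥ κ` -/
  relDensity : RelDensityGE c.U c.C c.κ
  /-- `μ̄(C ∖ G) ≤ ν` -/
  exceptional : DensityLE (fun AB ↦ c.C AB ∧ ¬ c.G AB) c.ν
  /-- `0 ≤ μ` -/
  hμ0 : 0 ≤ c.μ
  /-- `μ ≤ 1` -/
  hμ1 : c.μ ≤ 1
  /-- `0 ≤ κ` -/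
  hκ0 : 0 ≤ c.κ
  /-- `κ ≤ 1` -/
  hκ1 : c.κ ≤ 1
  /-- `0 ≤ ν` -/
  hν0 : 0 ≤ c.ν
  /-- the `p`-Selmer average on the averaging family is `≤ p + 1` (BSZ Thm 13) -/
  average : SelmerAverageLE inv c.p c.averagingFamily
  /-- the rank-`0` converse on `C ∩ G`, unless the mode is `rankOne` -/
  rankZero : c.mode ≠ Mode.rankOne → RankZeroConverseOn inv c.p c.C c.G
  /-- the rank-`1` converse on `C ∩ G`, unless the mode is `rankZero` -/
  rankOne : c.mode ≠ Mode.rankZero → RankOneConverseOn inv c.p c.C c.G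

/-- The `CellData` of a cell satisfying its hypotheses. [folklore] -/
def Cell.Holds.data {inv : Invariants} {c : Cell} (h : c.Holds inv) : CellData inv c.p where
  C := c.C
  U := c.U
  G := c.G
  hUC := h.hUC
  hU := h.paired.1
  hflip := h.paired.2
  hw := h.sign
  hDD := h.parity
  hGZK := h.gzk

/-- The `CellDensities` of a cell satisfying its hypotheses. [folklore] -/
theorem Cell.Holds.densities {inv : Invariants} {c : Cell} (h : c.Holds inv) :
    CellDensities h.data c.μ c.κ c.ν where
  hC := h.density
  hκ := h.relDensity
  hν := h.exceptional
  hμ1 := h.hμ1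
  hκ0 := h.hκ0
  hκ1 := h.hκ1
  hν0 := h.hν0

/-- **One cell.** Under its hypotheses, at least a proportion `c.value` of all elliptic curves over `ℚ`
ordered by height lie in the cell and satisfy the BSD rank conjecture with rank `≤ 1` (and finite `Ш`).
[cite: BhargavaSkinnerZhang2014, Cors 22, 24, 26] -/
theorem Cell.heightDensityGE (inv : Invariants) (c : Cell) (h : c.Holds inv) :
    HeightDensityGE (fun AB ↦ BSDRankLeOne inv AB ∧ c.C AB) c.value := by
  rcases c with ⟨p, C, U, G, μ, κ, ν, mode⟩
  cases mode with
  | both =>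
    have hav : SelmerAverageLE inv p C := h.average
    exact heightDensityGE_cell_both h.hp h.data h.densities hav (h.rankZero (by simp)) (h.rankOne (by simp))
      le_rfl
  | rankZero =>
    have hav : SelmerAverageLE inv p U := h.average
    exact heightDensityGE_cell_rank_zero h.hp h.data h.densities hav (h.rankZero (by simp)) h.hμ0 le_rfl
  | rankOne =>
    have hav : SelmerAverageLE inv p U := h.average
    exact heightDensityGE_cell_rank_one h.hp h.data h.densities hav (h.rankOne (by simp)) h.hμ0 le_rfl

/-- **The percentage theorem, abstract form.** If the cells `cell i` (`i ∈ s`) are pairwise disjoint and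
each satisfies its hypotheses, then at least a proportion `∑_{i ∈ s} (cell i).value` of all elliptic
curves `E_{A,B}` over `ℚ`, ordered by naive height, satisfy `rank E(ℚ) = ord_{s=1} L(E,s) ≤ 1` and
`Ш(E/ℚ)` finite. [cite: BhargavaSkinnerZhang2014, Thm 1 (method)] -/
theorem bsd_percentage (inv : Invariants) {ι : Type*} (s : Finset ι) (cell : ι → Cell)
    (hdisj : ∀ i ∈ s, ∀ j ∈ s, i ≠ j → ∀ AB, (cell i).C AB → ¬ (cell j).C AB)
    (h : ∀ i ∈ s, (cell i).Holds inv) :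
    HeightDensityGE (BSDRankLeOne inv) (∑ i ∈ s, (cell i).value) :=
  heightDensityGE_of_cells s (BSDRankLeOne inv) (fun i ↦ (cell i).C) (fun i ↦ (cell i).value) hdisj
    fun i hi ↦ Cell.heightDensityGE inv (cell i) (h i hi)

end Literature.NumberTheory.EllipticCurves.BhargavaSkinnerZhang2014
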